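import Summits.CriticalPhenomena.PercolationContinuityZ3.Theorems.PercNearOneGluingNoHeavyLowerTailSunflowerMultiPetalSlackMonotone
import HarnessLib
import HarnessLib.Audit

/-!
# `NoHeavyLowerTail` (crux stmt-CriticalPhenomena-4575), abstract sunflower cubic, `k` petals: PULLBACK of an `MSunflower` along a monotone set map (`comap`),
# the CONTRACTION / OFFSET structure `F.contract G` (`S ↦ lab (G ∪ S)`), and transport of the offset cube slack: `(F.contract G).pslack W ∅ = F.pslack W G`

Support file (seat `prim-l12-p2` gen 32; `--supports stmt-CriticalPhenomena-4575`; companion of `…SunflowerMultiPetalSlackMonotone` (p363882: `pslack W G`),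
`…SunflowerMultiPetalRestriction` (p340634: `ZKW`, `nested`) and `…SunflowerMultiPetalRestrict` (p367774: restriction to a sub-cube)).  Everything here is PROVED.
Memo: run/shared/lean/prim/prim-l12/prim-l12-p2/FINDING-g32.md §1.

* `MSunflower.comap F f hf` (`β` finite, `f : Finset β → Finset α` monotone): the monotone map `lab ∘ f` as an `MSunflower k β` (general-`k` analogue of the `k = 3`
  `Sunflower.comap` of `…SunflowerCloneOps`); `lab_comap : (F.comap f hf).lab S = F.lab (f S)`.
* `MSunflower.contract F G := F.comap (G ∪ ·)` — the OFFSET (contraction) structure; `lab_contract`; **`pslack_contract : (F.contract G).pslack W ∅ = F.pslack W G`** (so every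
  theorem about plain cube slacks is a theorem about offset slacks — e.g. the W-relative Theorem T of `…MultiPetalRestrictT` bounds the offset supplies
  `pslack Kᶜ (D ∩ K)` of the flip slot form, p368113); `pslack_contract_offset` (offsets compose: `(F.contract G).pslack W G' = F.pslack W (G ∪ G')`);
  `ZKW_contract : (F.contract G).ZKW W = nested W (s6K of the three offset labels)` — the chain-polarised functional `P(W; G, G, G)` of prove-1's (P3) with equal offsets.
-/

namespace Summit.CriticalPhenomena.PercolationContinuityZ3.Theorems.SunflowerPartition

open Finset

variable {α : Type*} [DecidableEq α]

namespace MSunflower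

variable {k : ℕ} (F : MSunflower k α)

/-! ## Pullback along a monotone set map -/

section Comap

variable {β : Type*} [DecidableEq β] [Fintype β] (f : Finset β → Finset α) (hf : Monotone f)

/-- **Pullback** of `F` along a monotone map `f : Finset β → Finset α` (`β` finite): kernel / petals are the preimages. [this work] -/
def comap : MSunflower k β where
  V i := univ.filter fun S => f S ∈ F.V i
  A := univ.filter fun S => f S ∈ F.A
  upperV := by
    intro i S T hST hS
    have hS' : f S ∈ F.V i := (mem_filter.1 hS).2
    exact mem_filter.2 ⟨mem_univ _, F.upperV i (hf hST) hS'⟩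
  upperA := by
    intro S T hST hS
    have hS' : f S ∈ F.A := (mem_filter.1 hS).2
    exact mem_filter.2 ⟨mem_univ _, F.upperA (hf hST) hS'⟩
  A_sub := by
    intro i S hS
    exact mem_filter.2 ⟨mem_univ _, F.A_sub i (mem_filter.1 hS).2⟩
  inter_sub := by
    intro i j hij S hS
    rw [mem_inter, mem_filter, mem_filter] at hS
    exact mem_filter.2 ⟨mem_univ _, F.inter_sub i j hij (mem_inter.2 ⟨hS.1.2, hS.2.2⟩)⟩

/-- Membership in the pulled-back kernel. [this work] -/
theorem mem_comap_A {S : Finset β} : S ∈ (F.comap f hf).A ↔ f S ∈ F.A := by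
  show S ∈ univ.filter (fun S => f S ∈ F.A) ↔ _
  rw [mem_filter]; exact ⟨fun h => h.2, fun h => ⟨mem_univ _, h⟩⟩

/-- Membership in a pulled-back petal up-set. [this work] -/
theorem mem_comap_V {i : Fin k} {S : Finset β} : S ∈ (F.comap f hf).V i ↔ f S ∈ F.V i := by
  show S ∈ univ.filter (fun S => f S ∈ F.V i) ↔ _
  rw [mem_filter]; exact ⟨fun h => h.2, fun h => ⟨mem_univ _, h⟩⟩

/-- **The pullback has the pulled-back labels**: `(F.comap f hf).lab S = F.lab (f S)`. [this work] -/
theorem lab_comap (S : Finset β) : (F.comap f hf).lab S = F.lab (f S) := by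
  rcases F.lab_cases (f S) with hA | h0 | ⟨i, hA, hV, hl⟩
  · rw [((F.comap f hf).lab_eq_last_iff S).2 ((F.mem_comap_A f hf).2 hA), (F.lab_eq_last_iff _).2 hA]
  · rw [h0]
    have h0' := (F.lab_eq_zero_iff _).1 h0
    exact ((F.comap f hf).lab_eq_zero_iff S).2
      ⟨fun h => h0'.1 ((F.mem_comap_A f hf).1 h), fun i h => h0'.2 i ((F.mem_comap_V f hf).1 h)⟩
  · rw [hl]
    exact (F.comap f hf).lab_eq_petalLab (fun h => hA ((F.mem_comap_A f hf).1 h)) ((F.mem_comap_V f hf).2 hV)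

end Comap

/-! ## The contraction / offset structure -/

section Contract

variable [Fintype α]

omit [Fintype α] in
/-- `S ↦ G ∪ S` is monotone. [this work] -/
theorem union_left_monotone (G : Finset α) : Monotone fun S : Finset α => G ∪ S :=
  fun _ _ h => union_subset_union (subset_refl G) h

/-- **CONTRACTION by `G`** (offset structure): the monotone map `S ↦ lab (G ∪ S)` as an `MSunflower`. [this work] -/
def contract (G : Finset α) : MSunflower k α := F.comap (fun S => G ∪ S) (union_left_monotone G)

/-- Labels of the contraction are the offset labels. [this work] -/
theorem lab_contract (G S : Finset α) : (F.contract G).lab S = F.lab (G ∪ S) := F.lab_comap _ _ S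

/-- **Offset slacks are plain slacks of the contraction**: `(F.contract G).pslack W ∅ = F.pslack W G`. [this work] -/
theorem pslack_contract (G W : Finset α) : (F.contract G).pslack W ∅ = F.pslack W G := by
  rw [pslack_empty_offset]
  unfold pslack
  refine sum_congr rfl fun S _ => ?_
  rw [lab_contract, lab_contract]

/-- Offsets compose: `(F.contract G).pslack W G' = F.pslack W (G ∪ G')`. [this work] -/
theorem pslack_contract_offset (G G' W : Finset α) : (F.contract G).pslack W G' = F.pslack W (G ∪ G') := by
  unfold pslack
  refine sum_congr rfl fun S _ => ?_
  rw [lab_contract, lab_contract, union_assoc, union_assoc]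

/-- The sub-cube functional of the contraction is the equal-offset polarised functional `Σ_{(X,Y,Z) ⊢ W} s6K (lab (G∪X)) (lab (G∪Y)) (lab (G∪Z))`
(prove-1's chain-polarised `P(W; G, G, G)`). [this work] -/
theorem ZKW_contract (G W : Finset α) :
    (F.contract G).ZKW W = nested W fun X Y Z => s6K k (F.lab (G ∪ X)) (F.lab (G ∪ Y)) (F.lab (G ∪ Z)) := by
  unfold ZKW nested
  refine sum_congr rfl fun X _ => sum_congr rfl fun S _ => ?_
  simp only [lab_contract]

/-- Example of use: under ★ₖ every equal-offset polarised sub-cube functional is nonnegative (★ₖ applied to the contraction, then restricted). [this work] -/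
theorem ZKW_contract_nonneg_of_partitionLemmaK {γ : Type} [DecidableEq γ] [Fintype γ] (F : MSunflower k γ) (h : PartitionLemmaK)
    (G : Finset γ) : 0 ≤ (F.contract G).ZK :=
  h k γ (F.contract G)

end Contract

end MSunflower

end Summit.CriticalPhenomena.PercolationContinuityZ3.Theorems.SunflowerPartition
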